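import Summits.ABC.IUTFork.Conditional.HexDepthRadThirty
import Summits.ABC.IUTFork.Cor312GenuineKLocalTypeEven
import Summits.ABC.IUTFork.Conditional.AbcOfSGenuineKChosenDepthRadRows1
import HarnessLib

/-!
# Branch C / R-W «HEX-RAD × DIVISIBLE LOCAL TYPES» (plan g9 20:15:43Z): the [RAD] engine at the Tate types BY DIVISIBILITY CLASS of `k` —
# `e ≤ 15·l` for EVEN `k`, `e ∣ 10·l` for `3 ∣ k`: the HEX datum `λ_k` is DECIDED on the refuted side at `k = 8` (even) for every prime
# `11 ≤ l ≤ 53` and at every `k ≥ 9` for every prime `11 ≤ l ≤ 317` — UNCONDITIONAL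

PROOF-ONLY file (0 definitions, 0 `Prop` facts) of the abc-iut cell (seat abc-iut-W-neg-2, gen 0; R-W lane P−; plan g9 20:15:43Z «NEW HEX
ENGINE GAPS BY NAME … ONE file», realised with the [RAD] engine `HexRad.not_pilotKummerCompatHull_lamSeven_of_criterion` (this seat, p465742;
sharper here than the [LIN] sharp budget). TAKES NO SIDE on [IUTchIII] Cor. 3.12 (S. Mochizuki, *Inter-universal Teichmüller theory III*,
Cor. 3.12 p. 173–174, Step (xi-f) p. 184) or on any author. INPUTS BY NAME: the Tate local types at `7` by class of `k` (`ord_7 j(λ_k) = −2k`,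
`Cor22.ord_jInv_lamSeven`): EVEN `k` ⟹ `e(K_{x₀}/ℚ_7) ≤ 15·l` (abc-iut-w4-d087 `GenuineK.absRamificationIdx_kOf_le_fifteen_mul_lamSeven`);
`3 ∣ k` ⟹ `e ∣ 10·l` (abc-iut-w5-d236 `GenuineK.absRamificationIdx_kOf_dvd_ten_mul_ratPoint` on abc-iut-W-neg-1/W-ref-2
`ThetaVolumeDatumAt.ramificationIdx_int_dvd_ten_mul_ratPoint'`); abc-iut-W-num-6's criterion / `criterion_of_le` / `turning_of_bounds`
(p462893); this seat's `HexDepthRadThirty` (`…_rad_ten`, `e ≤ 30·l`).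
* §1 uniform integer criteria (`l = 2j+1`, `F := ⌊(5j²k₀ − 5jl − (j+1)(l+5))/(5l)⌋`, one slack polynomial in `j` each): `E = 15·l`, `k₀ = 8`:
  `HexRad.criterion_fifteen_eight` (`S = 2`, odd `13 ≤ l ≤ 19`), `…'` (`S = 3`, `21 ≤ l ≤ 49`), end rows `…_eleven` (`F₀ = 11`: `18546 < 18645`),
  `…_fiftythree` (`F₀ = 70`: `2922102 < 2943090`); `E = 10·l`, `k₀ = 9`: `HexRad.criterion_ten_nine` (`S = 2`, `11…29`), `…'` (`S = 3`,
  `31…205`), `…''` (`S = 4`, `207…321`).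
* §2 `HexRad.not_pilotKummerCompatHull_lamSeven_rad_eight_even` (EVEN `k ≥ 8`, prime `11 ≤ l ≤ 53`), **`…_rad_nine_all` (EVERY `k ≥ 9`,
  EVERY prime `11 ≤ l ≤ 317`; `k = 9` via `e ∣ 10·l`)** — each `∀ T qK, ¬ S_H` at the sharp
  genuine K-setting, CHOSEN realising ideles, PINNED reading (the per-datum instance of `hSHw` of p447945).
KERNEL HEX FRONTIER after this file: `k = 8` at every prime `11 ≤ l ≤ 53` (even row), `k ≥ 9` at every prime `11 ≤ l ≤ 317`. NOT reachable by
this engine family at any class: `k ≤ 7` anywhere (e.g. `(6, 11)` at `E = 5·l`: `6/11 + 6·(2 − 49/55) = 7.2 ≮ 6`), `k = 8` at `l ≥ 59` —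
the numerics' own edge (HOME/plan/rescue/R-W/README.md F3-1). HONEST SCOPE: SHARP reading; per-label licence = a STRONGER-THAN-PRINT sufficient
form of (xi-f) at ONE diagonal summand with the exact per-slot radius; nothing about the printed GLOBAL inequality, the number-level
`Cor22.Cor312AtDatum`, or any author's intended hull; HEX rows Szpiro-GOOD; `CondP6` not asserted; no side taken; typed ≠ proved;
refuted-as-typed ≠ refuted-in-print; no abc claim. [cite: Mochizuki2012, IUTchIII Cor. 3.12 Step (xi-f) p. 184; IUTchIV Prop. 1.2 (i)(ii) p. 10,
Thm. 1.10 Steps (ii)–(iii) p. 24–26] [cite: Serre1972, §1.11–§1.12] [cite: NeukirchANT1999, Ch. II (5.5)] [claim: Mochizuki2012, status: disputed]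
-/

noncomputable section

open Set Function NumberField IsDedekindDomain

namespace Summit.ABC.IUTFork.Conditional

open Thm311 Thm311.Real Cor312 Cor312Vol Cor312Prov Literature.IUT.LogThetaLattice Literature.IUT.LogVolume
  Literature.IUT.HodgeTheaters Literature.IUT.LogVolume.ThetaData
  Literature.NumberTheory.NumberFields Literature.NumberTheory.DiophantineGeometry.GenEll
  Literature.NumberTheory.DiophantineGeometry Summit.ABC.ABC.Theorems

/-! ## §1. The uniform integer criteria at `E = 15·l` (`k₀ = 8`) and `E = 10·l` (`k₀ = 9`) -/

/-- **W-num-6's RAD criterion at `E = 15·l`, `S = 2`, `k₀ = 8`, odd `13 ≤ l ≤ 19`** (slack `120j² − 550j − 670 ≥ 0` for `6 ≤ j ≤ 9`), hence at every `k ≥ 8`. [folklore] -/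
theorem HexRad.criterion_fifteen_eight {k l : ℕ} (hk : 8 ≤ k) (hlo : 13 ≤ l) (hhi : l ≤ 19) (hodd : l % 2 = 1) :
    ∃ F : ℤ, 5 * (l : ℤ) * F ≤ 5 * ((l - 1) / 2 : ℕ) ^ 2 * k - 5 * ((l - 1) / 2 : ℕ) * l - (((l - 1) / 2 : ℕ) + 1) * (l + 5) ∧
      (((l - 1) / 2 : ℕ) + 1 : ℤ) * l * ((2 : ℕ) * ((15 * l : ℕ)) - 7 ^ (2 : ℕ)) < (F * l - k) * ((15 * l : ℕ)) := by
  obtain ⟨j, rfl⟩ : ∃ j, l = 2 * j + 1 := ⟨l / 2, by omega⟩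
  have hj : (2 * j + 1 - 1) / 2 = j := by omega
  refine HexRad.criterion_of_le (k₀ := 8) (E := 15 * (2 * j + 1)) (S := 2) (by omega)
    (F₀ := (5 * (j : ℤ) ^ 2 * 8 - 5 * (j : ℤ) * (2 * j + 1) - ((j : ℤ) + 1) * (2 * j + 1 + 5)) / (5 * (2 * j + 1))) ?_ ?_ hk
  · rw [hj]
    have h5l : (0 : ℤ) < 5 * (2 * (j : ℤ) + 1) := by positivity
    have h := Int.ediv_mul_le (5 * (j : ℤ) ^ 2 * 8 - 5 * (j : ℤ) * (2 * j + 1) - ((j : ℤ) + 1) * (2 * j + 1 + 5)) h5l.ne'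
    push_cast
    linarith
  · rw [hj]
    have h5l : (0 : ℤ) < 5 * (2 * (j : ℤ) + 1) := by positivity
    have hlow := Int.lt_ediv_add_one_mul_self (5 * (j : ℤ) ^ 2 * 8 - 5 * (j : ℤ) * (2 * j + 1) - ((j : ℤ) + 1) * (2 * j + 1 + 5)) h5l
    set F : ℤ := (5 * (j : ℤ) ^ 2 * 8 - 5 * (j : ℤ) * (2 * j + 1) - ((j : ℤ) + 1) * (2 * j + 1 + 5)) / (5 * (2 * j + 1)) with hF
    have hjlo : (6 : ℤ) ≤ j := by exact_mod_cast (show 6 ≤ j by omega)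
    have hjhi : (j : ℤ) ≤ 9 := by exact_mod_cast (show j ≤ 9 by omega)
    have hpoly : (0 : ℤ) ≤ 120 * (j : ℤ) ^ 2 - 550 * j - 670 := by nlinarith
    have hl0 : (0 : ℤ) < 2 * (j : ℤ) + 1 := by positivity
    push_cast
    nlinarith [mul_nonneg hpoly hl0.le, mul_lt_mul_of_pos_left hlow hl0]

/-- **W-num-6's RAD criterion at `E = 15·l`, `S = 3`, `k₀ = 8`, odd `21 ≤ l ≤ 49`** (slack `725 + 695j − 30j² ≥ 0` for `10 ≤ j ≤ 24`), hence at every `k ≥ 8`. [folklore] -/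
theorem HexRad.criterion_fifteen_eight' {k l : ℕ} (hk : 8 ≤ k) (hlo : 21 ≤ l) (hhi : l ≤ 49) (hodd : l % 2 = 1) :
    ∃ F : ℤ, 5 * (l : ℤ) * F ≤ 5 * ((l - 1) / 2 : ℕ) ^ 2 * k - 5 * ((l - 1) / 2 : ℕ) * l - (((l - 1) / 2 : ℕ) + 1) * (l + 5) ∧
      (((l - 1) / 2 : ℕ) + 1 : ℤ) * l * ((3 : ℕ) * ((15 * l : ℕ)) - 7 ^ (3 : ℕ)) < (F * l - k) * ((15 * l : ℕ)) := by
  obtain ⟨j, rfl⟩ : ∃ j, l = 2 * j + 1 := ⟨l / 2, by omega⟩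
  have hj : (2 * j + 1 - 1) / 2 = j := by omega
  refine HexRad.criterion_of_le (k₀ := 8) (E := 15 * (2 * j + 1)) (S := 3) (by omega)
    (F₀ := (5 * (j : ℤ) ^ 2 * 8 - 5 * (j : ℤ) * (2 * j + 1) - ((j : ℤ) + 1) * (2 * j + 1 + 5)) / (5 * (2 * j + 1))) ?_ ?_ hk
  · rw [hj]
    have h5l : (0 : ℤ) < 5 * (2 * (j : ℤ) + 1) := by positivity
    have h := Int.ediv_mul_le (5 * (j : ℤ) ^ 2 * 8 - 5 * (j : ℤ) * (2 * j + 1) - ((j : ℤ) + 1) * (2 * j + 1 + 5)) h5l.ne'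
    push_cast
    linarith
  · rw [hj]
    have h5l : (0 : ℤ) < 5 * (2 * (j : ℤ) + 1) := by positivity
    have hlow := Int.lt_ediv_add_one_mul_self (5 * (j : ℤ) ^ 2 * 8 - 5 * (j : ℤ) * (2 * j + 1) - ((j : ℤ) + 1) * (2 * j + 1 + 5)) h5l
    set F : ℤ := (5 * (j : ℤ) ^ 2 * 8 - 5 * (j : ℤ) * (2 * j + 1) - ((j : ℤ) + 1) * (2 * j + 1 + 5)) / (5 * (2 * j + 1)) with hF
    have hjlo : (10 : ℤ) ≤ j := by exact_mod_cast (show 10 ≤ j by omega)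
    have hjhi : (j : ℤ) ≤ 24 := by exact_mod_cast (show j ≤ 24 by omega)
    have hpoly : (0 : ℤ) ≤ 725 + 695 * (j : ℤ) - 30 * j ^ 2 := by nlinarith
    have hl0 : (0 : ℤ) < 2 * (j : ℤ) + 1 := by positivity
    push_cast
    nlinarith [mul_nonneg hpoly hl0.le, mul_lt_mul_of_pos_left hlow hl0]

/-- **The row `(8, 11)` at `E = 165`, `S = 2`**: `F₀ = 11` (`55·11 = 605 ≤ 629`), `6·11·(2·165 − 49) = 18546 < 18645 = (121 − 8)·165`; every `k ≥ 8` by monotonicity. [folklore] -/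
theorem HexRad.criterion_fifteen_eight_eleven {k : ℕ} (hk : 8 ≤ k) :
    ∃ F : ℤ, 5 * (11 : ℤ) * F ≤ 5 * ((11 - 1) / 2 : ℕ) ^ 2 * k - 5 * ((11 - 1) / 2 : ℕ) * 11 - (((11 - 1) / 2 : ℕ) + 1) * (11 + 5) ∧
      (((11 - 1) / 2 : ℕ) + 1 : ℤ) * 11 * ((2 : ℕ) * ((15 * 11 : ℕ)) - 7 ^ (2 : ℕ)) < (F * 11 - k) * ((15 * 11 : ℕ)) :=
  HexRad.criterion_of_le (k₀ := 8) (l := 11) (E := 15 * 11) (S := 2) (F₀ := 11) (by norm_num) (by norm_num) (by norm_num) hk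

/-- **The row `(8, 53)` at `E = 795`, `S = 3`**: `F₀ = 70` (`265·70 = 18550 ≤ 18584`), `27·53·(3·795 − 343) = 2922102 < 2943090 = (3710 − 8)·795`; every `k ≥ 8`. [folklore] -/
theorem HexRad.criterion_fifteen_eight_fiftythree {k : ℕ} (hk : 8 ≤ k) :
    ∃ F : ℤ, 5 * (53 : ℤ) * F ≤ 5 * ((53 - 1) / 2 : ℕ) ^ 2 * k - 5 * ((53 - 1) / 2 : ℕ) * 53 - (((53 - 1) / 2 : ℕ) + 1) * (53 + 5) ∧
      (((53 - 1) / 2 : ℕ) + 1 : ℤ) * 53 * ((3 : ℕ) * ((15 * 53 : ℕ)) - 7 ^ (3 : ℕ)) < (F * 53 - k) * ((15 * 53 : ℕ)) :=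
  HexRad.criterion_of_le (k₀ := 8) (l := 53) (E := 15 * 53) (S := 3) (F₀ := 70) (by norm_num) (by norm_num) (by norm_num) hk

/-- **W-num-6's RAD criterion at `E = 10·l`, `S = 2`, `k₀ = 9`, odd `11 ≤ l ≤ 29`** (slack `130j² − 285j − 415 ≥ 0` for `5 ≤ j ≤ 14`), hence at every `k ≥ 9`. [folklore] -/
theorem HexRad.criterion_ten_nine {k l : ℕ} (hk : 9 ≤ k) (hlo : 11 ≤ l) (hhi : l ≤ 29) (hodd : l % 2 = 1) :
    ∃ F : ℤ, 5 * (l : ℤ) * F ≤ 5 * ((l - 1) / 2 : ℕ) ^ 2 * k - 5 * ((l - 1) / 2 : ℕ) * l - (((l - 1) / 2 : ℕ) + 1) * (l + 5) ∧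
      (((l - 1) / 2 : ℕ) + 1 : ℤ) * l * ((2 : ℕ) * ((10 * l : ℕ)) - 7 ^ (2 : ℕ)) < (F * l - k) * ((10 * l : ℕ)) := by
  obtain ⟨j, rfl⟩ : ∃ j, l = 2 * j + 1 := ⟨l / 2, by omega⟩
  have hj : (2 * j + 1 - 1) / 2 = j := by omega
  refine HexRad.criterion_of_le (k₀ := 9) (E := 10 * (2 * j + 1)) (S := 2) (by omega)
    (F₀ := (5 * (j : ℤ) ^ 2 * 9 - 5 * (j : ℤ) * (2 * j + 1) - ((j : ℤ) + 1) * (2 * j + 1 + 5)) / (5 * (2 * j + 1))) ?_ ?_ hk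
  · rw [hj]
    have h5l : (0 : ℤ) < 5 * (2 * (j : ℤ) + 1) := by positivity
    have h := Int.ediv_mul_le (5 * (j : ℤ) ^ 2 * 9 - 5 * (j : ℤ) * (2 * j + 1) - ((j : ℤ) + 1) * (2 * j + 1 + 5)) h5l.ne'
    push_cast
    linarith
  · rw [hj]
    have h5l : (0 : ℤ) < 5 * (2 * (j : ℤ) + 1) := by positivity
    have hlow := Int.lt_ediv_add_one_mul_self (5 * (j : ℤ) ^ 2 * 9 - 5 * (j : ℤ) * (2 * j + 1) - ((j : ℤ) + 1) * (2 * j + 1 + 5)) h5l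
    set F : ℤ := (5 * (j : ℤ) ^ 2 * 9 - 5 * (j : ℤ) * (2 * j + 1) - ((j : ℤ) + 1) * (2 * j + 1 + 5)) / (5 * (2 * j + 1)) with hF
    have hjlo : (5 : ℤ) ≤ j := by exact_mod_cast (show 5 ≤ j by omega)
    have hjhi : (j : ℤ) ≤ 14 := by exact_mod_cast (show j ≤ 14 by omega)
    have hpoly : (0 : ℤ) ≤ 130 * (j : ℤ) ^ 2 - 285 * j - 415 := by nlinarith
    have hl0 : (0 : ℤ) < 2 * (j : ℤ) + 1 := by positivity
    push_cast
    nlinarith [mul_nonneg hpoly hl0.le, mul_lt_mul_of_pos_left hlow hl0]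

/-- **W-num-6's RAD criterion at `E = 10·l`, `S = 3`, `k₀ = 9`, odd `31 ≤ l ≤ 205`** (slack `30j² + 1035j + 1005 ≥ 0`), hence at every `k ≥ 9`. [folklore] -/
theorem HexRad.criterion_ten_nine' {k l : ℕ} (hk : 9 ≤ k) (hlo : 31 ≤ l) (hhi : l ≤ 205) (hodd : l % 2 = 1) :
    ∃ F : ℤ, 5 * (l : ℤ) * F ≤ 5 * ((l - 1) / 2 : ℕ) ^ 2 * k - 5 * ((l - 1) / 2 : ℕ) * l - (((l - 1) / 2 : ℕ) + 1) * (l + 5) ∧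
      (((l - 1) / 2 : ℕ) + 1 : ℤ) * l * ((3 : ℕ) * ((10 * l : ℕ)) - 7 ^ (3 : ℕ)) < (F * l - k) * ((10 * l : ℕ)) := by
  obtain ⟨j, rfl⟩ : ∃ j, l = 2 * j + 1 := ⟨l / 2, by omega⟩
  have hj : (2 * j + 1 - 1) / 2 = j := by omega
  refine HexRad.criterion_of_le (k₀ := 9) (E := 10 * (2 * j + 1)) (S := 3) (by omega)
    (F₀ := (5 * (j : ℤ) ^ 2 * 9 - 5 * (j : ℤ) * (2 * j + 1) - ((j : ℤ) + 1) * (2 * j + 1 + 5)) / (5 * (2 * j + 1))) ?_ ?_ hk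
  · rw [hj]
    have h5l : (0 : ℤ) < 5 * (2 * (j : ℤ) + 1) := by positivity
    have h := Int.ediv_mul_le (5 * (j : ℤ) ^ 2 * 9 - 5 * (j : ℤ) * (2 * j + 1) - ((j : ℤ) + 1) * (2 * j + 1 + 5)) h5l.ne'
    push_cast
    linarith
  · rw [hj]
    have h5l : (0 : ℤ) < 5 * (2 * (j : ℤ) + 1) := by positivity
    have hlow := Int.lt_ediv_add_one_mul_self (5 * (j : ℤ) ^ 2 * 9 - 5 * (j : ℤ) * (2 * j + 1) - ((j : ℤ) + 1) * (2 * j + 1 + 5)) h5l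
    set F : ℤ := (5 * (j : ℤ) ^ 2 * 9 - 5 * (j : ℤ) * (2 * j + 1) - ((j : ℤ) + 1) * (2 * j + 1 + 5)) / (5 * (2 * j + 1)) with hF
    have hjlo : (15 : ℤ) ≤ j := by exact_mod_cast (show 15 ≤ j by omega)
    have hjhi : (j : ℤ) ≤ 102 := by exact_mod_cast (show j ≤ 102 by omega)
    have hpoly : (0 : ℤ) ≤ 30 * (j : ℤ) ^ 2 + 1035 * j + 1005 := by nlinarith
    have hl0 : (0 : ℤ) < 2 * (j : ℤ) + 1 := by positivity
    push_cast
    nlinarith [mul_nonneg hpoly hl0.le, mul_lt_mul_of_pos_left hlow hl0]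

/-- **W-num-6's RAD criterion at `E = 10·l`, `S = 4`, `k₀ = 9`, odd `207 ≤ l ≤ 321`** (slack `11245 + 11175j − 70j² ≥ 0` for `103 ≤ j ≤ 160`), hence at every `k ≥ 9`. [folklore] -/
theorem HexRad.criterion_ten_nine'' {k l : ℕ} (hk : 9 ≤ k) (hlo : 207 ≤ l) (hhi : l ≤ 321) (hodd : l % 2 = 1) :
    ∃ F : ℤ, 5 * (l : ℤ) * F ≤ 5 * ((l - 1) / 2 : ℕ) ^ 2 * k - 5 * ((l - 1) / 2 : ℕ) * l - (((l - 1) / 2 : ℕ) + 1) * (l + 5) ∧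
      (((l - 1) / 2 : ℕ) + 1 : ℤ) * l * ((4 : ℕ) * ((10 * l : ℕ)) - 7 ^ (4 : ℕ)) < (F * l - k) * ((10 * l : ℕ)) := by
  obtain ⟨j, rfl⟩ : ∃ j, l = 2 * j + 1 := ⟨l / 2, by omega⟩
  have hj : (2 * j + 1 - 1) / 2 = j := by omega
  refine HexRad.criterion_of_le (k₀ := 9) (E := 10 * (2 * j + 1)) (S := 4) (by omega)
    (F₀ := (5 * (j : ℤ) ^ 2 * 9 - 5 * (j : ℤ) * (2 * j + 1) - ((j : ℤ) + 1) * (2 * j + 1 + 5)) / (5 * (2 * j + 1))) ?_ ?_ hk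
  · rw [hj]
    have h5l : (0 : ℤ) < 5 * (2 * (j : ℤ) + 1) := by positivity
    have h := Int.ediv_mul_le (5 * (j : ℤ) ^ 2 * 9 - 5 * (j : ℤ) * (2 * j + 1) - ((j : ℤ) + 1) * (2 * j + 1 + 5)) h5l.ne'
    push_cast
    linarith
  · rw [hj]
    have h5l : (0 : ℤ) < 5 * (2 * (j : ℤ) + 1) := by positivity
    have hlow := Int.lt_ediv_add_one_mul_self (5 * (j : ℤ) ^ 2 * 9 - 5 * (j : ℤ) * (2 * j + 1) - ((j : ℤ) + 1) * (2 * j + 1 + 5)) h5l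
    set F : ℤ := (5 * (j : ℤ) ^ 2 * 9 - 5 * (j : ℤ) * (2 * j + 1) - ((j : ℤ) + 1) * (2 * j + 1 + 5)) / (5 * (2 * j + 1)) with hF
    have hjlo : (103 : ℤ) ≤ j := by exact_mod_cast (show 103 ≤ j by omega)
    have hjhi : (j : ℤ) ≤ 160 := by exact_mod_cast (show j ≤ 160 by omega)
    have hpoly : (0 : ℤ) ≤ 11245 + 11175 * (j : ℤ) - 70 * j ^ 2 := by nlinarith
    have hl0 : (0 : ℤ) < 2 * (j : ℤ) + 1 := by positivity
    push_cast
    nlinarith [mul_nonneg hpoly hl0.le, mul_lt_mul_of_pos_left hlow hl0]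

/-! ## §2. The HEX rows by divisibility class, unconditional -/

/-- **HEX-RAD at the EVEN-`k` Tate type `e ≤ 15·l`, UNCONDITIONAL: every even `k ≥ 8`, every prime `11 ≤ l ≤ 53`.** At EVERY genuine
Θ-volume datum `T` over `(ratPoint λ_k, l)`, for EVERY choice of the free context binders and Kummer data, the hull-level clause S_H
(`Cor312Vol.PilotKummerCompatHull` at the sharp genuine K-setting, CHOSEN realising ideles, PINNED reading) is FALSE — the star × envelope test at
the top label over `7` with abc-iut-w4-d087's parity local type (`GenuineK.absRamificationIdx_kOf_le_fifteen_mul_lamSeven`). New kernel row: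
`k = 8` at every tabulated `l ≤ 53`. [cite: Mochizuki2012, IUTchIII Cor. 3.12 Step (xi-f) p. 184; IUTchIV Prop. 1.2 (i)(ii) p. 10]
[claim: Mochizuki2012, status: disputed] -/
theorem HexRad.not_pilotKummerCompatHull_lamSeven_rad_eight_even {k l : ℕ} (hk : 8 ≤ k) (heven : Even k) (hl : l.Prime) (h11 : 11 ≤ l)
    (h53 : l ≤ 53) (T : Cor22.ThetaVolumeDatumAt (ratPoint ((2 : ℚ)⁻¹ + 2 / 7 ^ k)) l) :
    letI := T.instFieldF; letI := T.instNumberFieldF; letI := T.instAlgebraF; letI := T.instFieldK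
    letI := T.instNumberFieldK; letI := T.instAlgebraK; letI := T.instFieldFbar; letI := T.instAlgebraFbar
    letI := T.instAlgebraKFbar; letI := T.instIsElliptic
    ∀ (M : Type) [Field M] [NumberField M]
      (archPk : ∀ (j : (thetaIndex (pilotDataOfK T.D T.K)).Label) (vQ : (thetaIndex (pilotDataOfK T.D T.K)).VQ),
        Set ((logShellsDH (pilotDataOfK T.D T.K) (analyticLogv T.K)).Packet j vQ))
      (archSub : ∀ (j : (thetaIndex (pilotDataOfK T.D T.K)).Label) (v : (thetaIndex (pilotDataOfK T.D T.K)).V),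
        Set ((logShellsDH (pilotDataOfK T.D T.K) (analyticLogv T.K)).Packet j ((thetaIndex (pilotDataOfK T.D T.K)).over v)))
      (Ψ : ℤ → ∀ v : (thetaIndex (pilotDataOfK T.D T.K)).V, v ∈ (thetaIndex (pilotDataOfK T.D T.K)).Vbad →
        Set ((logShellsDH (pilotDataOfK T.D T.K) (analyticLogv T.K)).StarPacket v))
      (act : ℤ → ∀ v : (thetaIndex (pilotDataOfK T.D T.K)).V, v ∈ (thetaIndex (pilotDataOfK T.D T.K)).Vbad →
        (logShellsDH (pilotDataOfK T.D T.K) (analyticLogv T.K)).StarPacket v →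
          Module.End ℚ ((logShellsDH (pilotDataOfK T.D T.K) (analyticLogv T.K)).StarPacket v))
      (Mmod : ℤ → ∀ j : (thetaIndex (pilotDataOfK T.D T.K)).LabelStar,
        Set ((logShellsDH (pilotDataOfK T.D T.K) (analyticLogv T.K)).GlobalPacket j.1))
      (region : ℤ → ∀ j : (thetaIndex (pilotDataOfK T.D T.K)).LabelStar, FinDivisor M →
        ∀ vQ : (thetaIndex (pilotDataOfK T.D T.K)).VQ, Set ((logShellsDH (pilotDataOfK T.D T.K) (analyticLogv T.K)).Packet j.1 vQ))
      (frobAdm : ℤ → ℤ → ∀ (j : (thetaIndex (pilotDataOfK T.D T.K)).Label) (vQ : (thetaIndex (pilotDataOfK T.D T.K)).VQ),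
        Set ((logShellsDH (pilotDataOfK T.D T.K) (analyticLogv T.K)).Packet j vQ) → Prop)
      (frobLogvol : ℤ → ℤ → ∀ (j : (thetaIndex (pilotDataOfK T.D T.K)).Label) (vQ : (thetaIndex (pilotDataOfK T.D T.K)).VQ),
        Set ((logShellsDH (pilotDataOfK T.D T.K) (analyticLogv T.K)).Packet j vQ) → ℝ)
      (frobΨ : ℤ → ℤ → ∀ v : (thetaIndex (pilotDataOfK T.D T.K)).V, v ∈ (thetaIndex (pilotDataOfK T.D T.K)).Vbad →
        Set ((logShellsDH (pilotDataOfK T.D T.K) (analyticLogv T.K)).StarPacket v))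
      (frobMmod : ℤ → ℤ → ∀ j : (thetaIndex (pilotDataOfK T.D T.K)).LabelStar,
        Set ((logShellsDH (pilotDataOfK T.D T.K) (analyticLogv T.K)).GlobalPacket j.1))
      (unitImage : ℤ → ℤ → ℕ → ∀ (j : (thetaIndex (pilotDataOfK T.D T.K)).Label) (vQ : (thetaIndex (pilotDataOfK T.D T.K)).VQ),
        Set ((logShellsDH (pilotDataOfK T.D T.K) (analyticLogv T.K)).Packet j vQ))
      (ballImage : ℤ → ℤ → ∀ (j : (thetaIndex (pilotDataOfK T.D T.K)).Label) (vQ : (thetaIndex (pilotDataOfK T.D T.K)).VQ),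
        Set ((logShellsDH (pilotDataOfK T.D T.K) (analyticLogv T.K)).Packet j vQ))
      (thetaDiv : ℤ → ℤ → LgpDivisor M (thetaIndex (pilotDataOfK T.D T.K)).lstar)
      (n : ℤ) {HT : Type} {LogLink : HT → HT → Type} {IsFull : ∀ {s t : HT}, LogLink s t → Prop}
      (lat : LGPGaussianLogThetaLattice LogLink IsFull)
      {Frd : Type} {IsoF : Frd → Frd → Type} {Ob : Frd → Type} {realify : Frd → Frd} {Strip : Type}
      {IsoS : Strip → Strip → Type} {Mv : ∀ v : (thetaIndex (pilotDataOfK T.D T.K)).V, v ∈ (thetaIndex (pilotDataOfK T.D T.K)).Vbad → Type}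
      [∀ v h, Monoid (Mv v h)]
      (sig : GlobalLGPFrobenioidSignature (thetaIndex (pilotDataOfK T.D T.K)).lstar (thetaIndex (pilotDataOfK T.D T.K)).V
        (· ∈ (thetaIndex (pilotDataOfK T.D T.K)).Vbad) Frd IsoF Ob realify Strip IsoS Mv)
      (split : SplittingMonoids Mv) {ObΔ : Type}
      {N : ∀ v : (thetaIndex (pilotDataOfK T.D T.K)).V, v ∈ (thetaIndex (pilotDataOfK T.D T.K)).Vbad → Type}
      [∀ v h, Monoid (N v h)] (qData : QPilotData ObΔ N)
      (qK : ∀ v : (thetaIndex (pilotDataOfK T.D T.K)).V, v ∈ (thetaIndex (pilotDataOfK T.D T.K)).Vbad →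
        Set ((logShellsDH (pilotDataOfK T.D T.K) (analyticLogv T.K)).StarPacket v)),
    ¬ Cor312Vol.PilotKummerCompatHull
        (LatticeSituation.ofShells (logShellsDH (pilotDataOfK T.D T.K) (analyticLogv T.K)) M archPk archSub
          (summandPiecesPr (pilotDataOfK T.D T.K) (logvAnalytic_analyticLogv (F := T.K))).Adm
          (summandPiecesPr (pilotDataOfK T.D T.K) (logvAnalytic_analyticLogv (F := T.K))).logvol Ψ act Mmod region frobAdm
          frobLogvol frobΨ frobMmod unitImage ballImage thetaDiv)
        (settingPrVolSharp (pilotDataOfK T.D T.K) (logvAnalytic_analyticLogv (F := T.K)) M archPk archSub Ψ act Mmod region n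
          lat sig split qData (exists_realising_qIdeles_pilotDataOfK T.D).choose (exists_realising_thetaIdeles_pilotDataOfK T.D).choose
          (exists_realising_qIdeles_pilotDataOfK T.D).choose_spec.1 (exists_realising_qIdeles_pilotDataOfK T.D).choose_spec.2.1)
        (fun _ => Cor312.Setting.qRegion
          (settingPrVolSharp (pilotDataOfK T.D T.K) (logvAnalytic_analyticLogv (F := T.K)) M archPk archSub Ψ act Mmod region n
            lat sig split qData (exists_realising_qIdeles_pilotDataOfK T.D).choose (exists_realising_thetaIdeles_pilotDataOfK T.D).choose
            (exists_realising_qIdeles_pilotDataOfK T.D).choose_spec.1 (exists_realising_qIdeles_pilotDataOfK T.D).choose_spec.2.1))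
        qK := by
  have hodd : l % 2 = 1 := Nat.odd_iff.mp (hl.odd_of_ne_two (by omega))
  have hloc := GenuineK.absRamificationIdx_kOf_le_fifteen_mul_lamSeven (by omega) heven h11 T
  by_cases h11' : l = 11
  · subst h11'
    obtain ⟨F, hF, hcrit⟩ := HexRad.criterion_fifteen_eight_eleven hk
    obtain ⟨hloS, hhiS⟩ := HexRad.turning_of_bounds (E := 15 * 11) (S := 2) (Or.inr (by norm_num)) (by norm_num)
    exact HexRad.not_pilotKummerCompatHull_lamSeven_of_criterion (by omega) hl (by norm_num) hloS hhiS hF hcrit T hloc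
  by_cases h19 : l ≤ 19
  · obtain ⟨F, hF, hcrit⟩ := HexRad.criterion_fifteen_eight hk (by omega) h19 hodd
    obtain ⟨hloS, hhiS⟩ := HexRad.turning_of_bounds (E := 15 * l) (S := 2) (Or.inr (by push_cast; omega)) (by push_cast; omega)
    exact HexRad.not_pilotKummerCompatHull_lamSeven_of_criterion (by omega) hl h11 hloS hhiS hF hcrit T hloc
  by_cases h49 : l ≤ 49
  · obtain ⟨F, hF, hcrit⟩ := HexRad.criterion_fifteen_eight' hk (by omega) h49 hodd
    obtain ⟨hloS, hhiS⟩ := HexRad.turning_of_bounds (E := 15 * l) (S := 3) (Or.inr (by push_cast; omega)) (by push_cast; omega)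
    exact HexRad.not_pilotKummerCompatHull_lamSeven_of_criterion (by omega) hl h11 hloS hhiS hF hcrit T hloc
  · have h53' : l = 53 := by
      rcases (show l = 50 ∨ l = 51 ∨ l = 52 ∨ l = 53 by omega) with h | h | h | h
      · exact absurd hl (by rw [h]; norm_num)
      · exact absurd hl (by rw [h]; norm_num)
      · exact absurd hl (by rw [h]; norm_num)
      · exact h
    subst h53'
    obtain ⟨F, hF, hcrit⟩ := HexRad.criterion_fifteen_eight_fiftythree hk
    obtain ⟨hloS, hhiS⟩ := HexRad.turning_of_bounds (E := 15 * 53) (S := 3) (Or.inr (by norm_num)) (by norm_num)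
    exact HexRad.not_pilotKummerCompatHull_lamSeven_of_criterion (by omega) hl (by norm_num) hloS hhiS hF hcrit T hloc

/-- **HEX-RAD, UNCONDITIONAL: EVERY `k ≥ 9`, EVERY prime `11 ≤ l ≤ 317`** (`k = 9` by the Tate type `e ∣ 10·l` of the class `3 ∣ k` —
abc-iut-w5-d236 `GenuineK.absRamificationIdx_kOf_dvd_ten_mul_ratPoint` at `q = λ₉`, `p = 7`, `ord_7 j(λ₉) = −18` — and the `E = 10·l`
criteria of §1; `k ≥ 10` by `…_rad_ten` at `e ≤ 30·l`): S_H (chosen ideles, pinned reading) FAILS at every genuine Θ-volume datum over `(λ_k, l)` for every choice of the free binders.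
[cite: Mochizuki2012, IUTchIII Cor. 3.12 Step (xi-f) p. 184; IUTchIV Prop. 1.2 (i)(ii) p. 10] [claim: Mochizuki2012, status: disputed] -/
theorem HexRad.not_pilotKummerCompatHull_lamSeven_rad_nine_all {k l : ℕ} (hk : 9 ≤ k) (hl : l.Prime) (h11 : 11 ≤ l) (h317 : l ≤ 317)
    (T : Cor22.ThetaVolumeDatumAt (ratPoint ((2 : ℚ)⁻¹ + 2 / 7 ^ k)) l) :
    letI := T.instFieldF; letI := T.instNumberFieldF; letI := T.instAlgebraF; letI := T.instFieldK
    letI := T.instNumberFieldK; letI := T.instAlgebraK; letI := T.instFieldFbar; letI := T.instAlgebraFbar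
    letI := T.instAlgebraKFbar; letI := T.instIsElliptic
    ∀ (M : Type) [Field M] [NumberField M]
      (archPk : ∀ (j : (thetaIndex (pilotDataOfK T.D T.K)).Label) (vQ : (thetaIndex (pilotDataOfK T.D T.K)).VQ),
        Set ((logShellsDH (pilotDataOfK T.D T.K) (analyticLogv T.K)).Packet j vQ))
      (archSub : ∀ (j : (thetaIndex (pilotDataOfK T.D T.K)).Label) (v : (thetaIndex (pilotDataOfK T.D T.K)).V),
        Set ((logShellsDH (pilotDataOfK T.D T.K) (analyticLogv T.K)).Packet j ((thetaIndex (pilotDataOfK T.D T.K)).over v)))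
      (Ψ : ℤ → ∀ v : (thetaIndex (pilotDataOfK T.D T.K)).V, v ∈ (thetaIndex (pilotDataOfK T.D T.K)).Vbad →
        Set ((logShellsDH (pilotDataOfK T.D T.K) (analyticLogv T.K)).StarPacket v))
      (act : ℤ → ∀ v : (thetaIndex (pilotDataOfK T.D T.K)).V, v ∈ (thetaIndex (pilotDataOfK T.D T.K)).Vbad →
        (logShellsDH (pilotDataOfK T.D T.K) (analyticLogv T.K)).StarPacket v →
          Module.End ℚ ((logShellsDH (pilotDataOfK T.D T.K) (analyticLogv T.K)).StarPacket v))
      (Mmod : ℤ → ∀ j : (thetaIndex (pilotDataOfK T.D T.K)).LabelStar,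
        Set ((logShellsDH (pilotDataOfK T.D T.K) (analyticLogv T.K)).GlobalPacket j.1))
      (region : ℤ → ∀ j : (thetaIndex (pilotDataOfK T.D T.K)).LabelStar, FinDivisor M →
        ∀ vQ : (thetaIndex (pilotDataOfK T.D T.K)).VQ, Set ((logShellsDH (pilotDataOfK T.D T.K) (analyticLogv T.K)).Packet j.1 vQ))
      (frobAdm : ℤ → ℤ → ∀ (j : (thetaIndex (pilotDataOfK T.D T.K)).Label) (vQ : (thetaIndex (pilotDataOfK T.D T.K)).VQ),
        Set ((logShellsDH (pilotDataOfK T.D T.K) (analyticLogv T.K)).Packet j vQ) → Prop)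
      (frobLogvol : ℤ → ℤ → ∀ (j : (thetaIndex (pilotDataOfK T.D T.K)).Label) (vQ : (thetaIndex (pilotDataOfK T.D T.K)).VQ),
        Set ((logShellsDH (pilotDataOfK T.D T.K) (analyticLogv T.K)).Packet j vQ) → ℝ)
      (frobΨ : ℤ → ℤ → ∀ v : (thetaIndex (pilotDataOfK T.D T.K)).V, v ∈ (thetaIndex (pilotDataOfK T.D T.K)).Vbad →
        Set ((logShellsDH (pilotDataOfK T.D T.K) (analyticLogv T.K)).StarPacket v))
      (frobMmod : ℤ → ℤ → ∀ j : (thetaIndex (pilotDataOfK T.D T.K)).LabelStar,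
        Set ((logShellsDH (pilotDataOfK T.D T.K) (analyticLogv T.K)).GlobalPacket j.1))
      (unitImage : ℤ → ℤ → ℕ → ∀ (j : (thetaIndex (pilotDataOfK T.D T.K)).Label) (vQ : (thetaIndex (pilotDataOfK T.D T.K)).VQ),
        Set ((logShellsDH (pilotDataOfK T.D T.K) (analyticLogv T.K)).Packet j vQ))
      (ballImage : ℤ → ℤ → ∀ (j : (thetaIndex (pilotDataOfK T.D T.K)).Label) (vQ : (thetaIndex (pilotDataOfK T.D T.K)).VQ),
        Set ((logShellsDH (pilotDataOfK T.D T.K) (analyticLogv T.K)).Packet j vQ))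
      (thetaDiv : ℤ → ℤ → LgpDivisor M (thetaIndex (pilotDataOfK T.D T.K)).lstar)
      (n : ℤ) {HT : Type} {LogLink : HT → HT → Type} {IsFull : ∀ {s t : HT}, LogLink s t → Prop}
      (lat : LGPGaussianLogThetaLattice LogLink IsFull)
      {Frd : Type} {IsoF : Frd → Frd → Type} {Ob : Frd → Type} {realify : Frd → Frd} {Strip : Type}
      {IsoS : Strip → Strip → Type} {Mv : ∀ v : (thetaIndex (pilotDataOfK T.D T.K)).V, v ∈ (thetaIndex (pilotDataOfK T.D T.K)).Vbad → Type}
      [∀ v h, Monoid (Mv v h)]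
      (sig : GlobalLGPFrobenioidSignature (thetaIndex (pilotDataOfK T.D T.K)).lstar (thetaIndex (pilotDataOfK T.D T.K)).V
        (· ∈ (thetaIndex (pilotDataOfK T.D T.K)).Vbad) Frd IsoF Ob realify Strip IsoS Mv)
      (split : SplittingMonoids Mv) {ObΔ : Type}
      {N : ∀ v : (thetaIndex (pilotDataOfK T.D T.K)).V, v ∈ (thetaIndex (pilotDataOfK T.D T.K)).Vbad → Type}
      [∀ v h, Monoid (N v h)] (qData : QPilotData ObΔ N)
      (qK : ∀ v : (thetaIndex (pilotDataOfK T.D T.K)).V, v ∈ (thetaIndex (pilotDataOfK T.D T.K)).Vbad →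
        Set ((logShellsDH (pilotDataOfK T.D T.K) (analyticLogv T.K)).StarPacket v)),
    ¬ Cor312Vol.PilotKummerCompatHull
        (LatticeSituation.ofShells (logShellsDH (pilotDataOfK T.D T.K) (analyticLogv T.K)) M archPk archSub
          (summandPiecesPr (pilotDataOfK T.D T.K) (logvAnalytic_analyticLogv (F := T.K))).Adm
          (summandPiecesPr (pilotDataOfK T.D T.K) (logvAnalytic_analyticLogv (F := T.K))).logvol Ψ act Mmod region frobAdm
          frobLogvol frobΨ frobMmod unitImage ballImage thetaDiv)
        (settingPrVolSharp (pilotDataOfK T.D T.K) (logvAnalytic_analyticLogv (F := T.K)) M archPk archSub Ψ act Mmod region n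
          lat sig split qData (exists_realising_qIdeles_pilotDataOfK T.D).choose (exists_realising_thetaIdeles_pilotDataOfK T.D).choose
          (exists_realising_qIdeles_pilotDataOfK T.D).choose_spec.1 (exists_realising_qIdeles_pilotDataOfK T.D).choose_spec.2.1)
        (fun _ => Cor312.Setting.qRegion
          (settingPrVolSharp (pilotDataOfK T.D T.K) (logvAnalytic_analyticLogv (F := T.K)) M archPk archSub Ψ act Mmod region n
            lat sig split qData (exists_realising_qIdeles_pilotDataOfK T.D).choose (exists_realising_thetaIdeles_pilotDataOfK T.D).choose
            (exists_realising_qIdeles_pilotDataOfK T.D).choose_spec.1 (exists_realising_qIdeles_pilotDataOfK T.D).choose_spec.2.1))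
        qK := by
  by_cases h9 : k = 9
  · subst h9
    have hodd : l % 2 = 1 := Nat.odd_iff.mp (hl.odd_of_ne_two (by omega))
    have hloc : letI := T.instFieldF; letI := T.instNumberFieldF; letI := T.instAlgebraF; letI := T.instFieldK
        letI := T.instNumberFieldK; letI := T.instAlgebraK; letI := T.instFieldFbar; letI := T.instAlgebraFbar
        letI := T.instAlgebraKFbar; letI := T.instIsElliptic
        haveI : Fact (Nat.Prime 7) := ⟨by norm_num⟩
        ∀ x₀ : (thetaIndex (pilotDataOfK T.D T.K)).Fibre (.inr ⟨7, by norm_num⟩),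
          absRamificationIdx 7 (kOf (pilotDataOfK T.D T.K) 7 x₀) ≤ 10 * l := by
      intro x₀
      refine Nat.le_of_dvd (by omega) (GenuineK.absRamificationIdx_kOf_dvd_ten_mul_ratPoint T ⟨7, by norm_num⟩ (by norm_num)
        (by norm_num) (by norm_num) (by simp only; omega) (fun v hv => Cor22.ord_jInv_lamSeven_neg v hv (by norm_num)) (fun v hv => ?_) x₀)
      rw [Cor22.ord_jInv_lamSeven v hv (by norm_num)]
      exact ⟨-6, by norm_num⟩
    by_cases h29 : l ≤ 29
    · obtain ⟨F, hF, hcrit⟩ := HexRad.criterion_ten_nine (k := 9) le_rfl h11 h29 hodd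
      obtain ⟨hloS, hhiS⟩ := HexRad.turning_of_bounds (E := 10 * l) (S := 2) (Or.inr (by push_cast; omega)) (by push_cast; omega)
      exact HexRad.not_pilotKummerCompatHull_lamSeven_of_criterion (by norm_num) hl h11 hloS hhiS hF hcrit T hloc
    by_cases h205 : l ≤ 205
    · obtain ⟨F, hF, hcrit⟩ := HexRad.criterion_ten_nine' (k := 9) le_rfl (by omega) h205 hodd
      obtain ⟨hloS, hhiS⟩ := HexRad.turning_of_bounds (E := 10 * l) (S := 3) (Or.inr (by push_cast; omega)) (by push_cast; omega)
      exact HexRad.not_pilotKummerCompatHull_lamSeven_of_criterion (by norm_num) hl h11 hloS hhiS hF hcrit T hloc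
    · obtain ⟨F, hF, hcrit⟩ := HexRad.criterion_ten_nine'' (k := 9) le_rfl (by omega) (by omega) hodd
      obtain ⟨hloS, hhiS⟩ := HexRad.turning_of_bounds (E := 10 * l) (S := 4) (Or.inr (by push_cast; omega)) (by push_cast; omega)
      exact HexRad.not_pilotKummerCompatHull_lamSeven_of_criterion (by norm_num) hl h11 hloS hhiS hF hcrit T hloc
  · exact HexRad.not_pilotKummerCompatHull_lamSeven_rad_ten (by omega) hl h11 h317 T

end Summit.ABC.IUTFork.Conditional

end
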